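import Summits.QuantumFields.BalabanUV.T4Continuum.Support.U3PolymerDictionary
import Literature.MathematicalPhysics.QuantumFieldTheory.Balaban1983to89.T4HistoryLipschitzSegment

/-!
# U3 substrate — the polymer dictionary for NE9's ANALYTIC BINDERS: the step-volume sums, the majorant clauses and the
# Kotecký–Preiss clause of `TwoPointKP` ∕ `hCup` over `(cubeChart R).geom` READ ON NE5's domains `R.domAt`

Cell `pub-balaban`, SUBSTRATE cell seat `b2b-balaban-substrate-p2` ([dict] identification layer ∕ «U3 typed ONCE»; third file of the
dictionary, after `Support/U3PolymerDictionary` (geometries) and `…Record` (activities of record)).  Summits-side bookkeeping; imported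
modules used BY NAME, nothing edited.

HONEST FRAMING (T4-DAG p. 1).  Rung (B)+1 of the FINITE-VOLUME T⁴ continuum programme — NOT infinite volume, NOT a mass gap, NOT the
Clay problem, NOT a proof of NE5 or NE9 (NOT PRINTED).  HONEST DEPENDENCY (cell line, verbatim): continuum YM on T⁴ ⇐ BetaPertH ∧ nine
spine estimates (0/9 proved); BetaPertH ⇐ (D1) ∧ (D4) ∧ CAP+tail; G-an2-4 gates asym, D1 and NE2/3/4.  DICTIONARY only: 0 estimate, no
`def … : Prop`, nothing printed asserted; the binders below stay HYPOTHESES of row NE9 — this file only lets them be STATED and SUPPLIED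
on NE5's polymers.

WHAT THIS FILE DOES.  Row NE9's END faces on the carriers of record (`Spine/NE9/CarriersOfRecordFaces.rec_ne9_and_fadingMemory_of_
couplingTwoPoint` and siblings) display, besides the model leaves, two ANALYTIC binders over the cube-chart geometry: L-A1
`TwoPointKP (cubeChart R).geom W act 𝒜 n lip (sizeWeight a₁) (sizeWeight d₁)` and L-A2 `hCup` — both quantify over NE9's step volume
`(cubeChart R).geom.vol X` (connected cube families) and L-A1's third clause is the Kotecký–Preiss sum `Σ_{γ′ ∈ vol X, inc γ′ γ} 2n(γ′)·
e^{a(γ′)+d(γ′)} ≤ a(γ)` with CUBE-COUNT size weights `a₁·#γ`, `d₁·#γ`.  By `U3PolymerDictionary.vol_cubeChart_eq` the step volume is the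
image of NE5's catalogue `R.domAt X.1` under the footprint, so:
* §1 **`forall_vol_cubeChart_iff`** (a clause over NE9's step volume ⇔ the clause over NE5's catalogue at footprints),
  **`sum_vol_filter_inc_eq`** (the KP sum over NE9's incompatible neighbours of a footprint = the sum over NE5's touching domains, hard
  core of record `touchInc`), `card_footprint'` (`#(footprint Z) = #Z`, so `sizeWeight a₁ (footprint Z) = a₁·#Z`);
* §2 **`twoPointKP_cubeChart_of_domains`**: L-A1 for activity ∕ majorant families that READ domain families on footprints FOLLOWS from
  the same three clauses stated over `R.domAt` with the hard core `touchInc` and the weights `a₁·#Z`, `d₁·#Z` (and `0 ≤ a₁, d₁`) — the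
  currency of NE5's route-P2 `KPInflated`-type binders;
* §3 **`cup_cubeChart_of_domains`**: the same for L-A2 `hCup` (coupling two-point clause at the activity level).
So an `act` ∕ majorant pair typed ONCE on the domains of record, with its Kotecký–Preiss smallness stated ONCE there, serves NE9's END
faces through the reading; nothing is discharged.  Spine PROVED 0∕9 unchanged.

References (KIND only): [Balaban1988RG2Cluster] (2.11)–(2.15) pp. 14–15, Lemma 3 (2.38) p. 20; [KoteckyPreiss1986] (1)–(3).
-/

noncomputable section

open scoped BigOperators

namespace Summit.QuantumFields.BalabanUV.T4Continuum.U3PolymerDictionaryKP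

open Literature.MathematicalPhysics.QuantumFieldTheory.Balaban1983to89
open Literature.MathematicalPhysics.QuantumFieldTheory.Balaban1983to89.T4HistoryLipschitzActivity (ClusterGeom)
open Literature.MathematicalPhysics.QuantumFieldTheory.Balaban1983to89.T4HistoryLipschitzCubeGeometry (CubeChart CubeInc)
open Literature.MathematicalPhysics.QuantumFieldTheory.Balaban1983to89.T4HistoryLipschitzEntropy (Supported)
open Literature.MathematicalPhysics.QuantumFieldTheory.Balaban1983to89.T4HistoryLipschitzSegment (TwoPointKP)
open Summit.QuantumFields.BalabanUV.T4Continuum.B13Carriers (TwoRuns)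
open Summit.QuantumFields.BalabanUV.T4Continuum.B13DomainGeometryTR (SCube SAdj footprint card_footprint domainGeometry)
open Summit.QuantumFields.BalabanUV.T4Continuum.B13CarriersCubeChart (cubeChart)
open Summit.QuantumFields.BalabanUV.T4Continuum.B13StepTermSocket (touchInc)
open Summit.QuantumFields.BalabanUV.T4Continuum.U3PolymerDictionary

variable {G : Type} [GaugeGroup G] {R : TwoRuns G}

/-! ## §1 Clauses and Kotecký–Preiss sums over NE9's step volume, read on NE5's catalogue -/

/-- [folklore] **A CLAUSE OVER NE9's STEP VOLUME ⇔ THE CLAUSE OVER NE5's CATALOGUE AT FOOTPRINTS.** -/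
theorem forall_vol_cubeChart_iff {X : R.carriers.Dom} {p : Finset (SCube R) → Prop} :
    (∀ γ ∈ (cubeChart R).geom.vol X, p γ) ↔ ∀ Z ∈ R.domAt X.1, p (footprint Z) := by
  rw [CubeChart.geom_vol, vol_cubeChart_eq]
  constructor
  · intro h Z hZ
    exact h _ (Finset.mem_image_of_mem _ hZ)
  · intro h γ hγ
    obtain ⟨Z, hZ, rfl⟩ := Finset.mem_image.1 hγ
    exact h Z hZ

/-- [folklore] The incompatibility of NE9's geometry of record on footprints is NE5's hard core of record. -/
theorem geom_inc_footprint_iff (Z Z' : R.carriers.Dom) :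
    (cubeChart R).geom.inc (footprint Z') (footprint Z) ↔ touchInc (domainGeometry R) Z' Z := by
  rw [CubeChart.geom_inc]
  exact cubeInc_footprint_iff_touchInc Z' Z

/-- [folklore] **THE KOTECKÝ–PREISS SUM OVER NE9's INCOMPATIBLE NEIGHBOURS OF A FOOTPRINT = THE SUM OVER NE5's TOUCHING DOMAINS**
(hard core of record `touchInc`), for any summand. -/
theorem sum_vol_filter_inc_eq (f : Finset (SCube R) → ℝ) (X Z : R.carriers.Dom) :
    ∑ γ' ∈ (cubeChart R).geom.vol X with (cubeChart R).geom.inc γ' (footprint Z), f γ' =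
      ∑ Z' ∈ R.domAt X.1 with touchInc (domainGeometry R) Z' Z, f (footprint Z') := by
  rw [CubeChart.geom_vol, vol_cubeChart_eq, Finset.sum_filter, Finset.sum_filter]
  refine (Finset.sum_image fun a _ b _ h => footprint_injective h).trans ?_
  exact Finset.sum_congr rfl fun Z' _ => if_congr (geom_inc_footprint_iff Z Z') rfl rfl

/-- [folklore] `#(footprint Z) = #Z` (the cube count of the domain), restated for the size weights. -/
theorem card_footprint' (Z : R.carriers.Dom) : ((footprint Z).card : ℝ) = (Z.2.1.card : ℝ) := by
  rw [card_footprint]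

/-- [folklore] NE9's cube-count size weight of a footprint is `a₁ · #Z`. -/
theorem sizeWeight_footprint (a₁ : ℝ) (Z : R.carriers.Dom) :
    (cubeChart R).supported.sizeWeight a₁ (footprint Z) = a₁ * (Z.2.1.card : ℝ) := by
  rw [CubeChart.supported_sizeWeight, card_footprint']

/-! ## §2 L-A1 `TwoPointKP` on the geometry of record from the three clauses on NE5's domains -/

/-- [folklore] **L-A1 FROM THE DOMAIN SIDE.**  Let NE9's activity `act` and majorant `n` READ domain families `act₅`, `n₅` on
footprints.  If, on the window, at every scale-`(k+1)` domain `X`: (i) for admissible tables every domain of the catalogue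
`R.domAt X.1` has its activity bounded by the majorant, (ii) the table two-point clause holds with scale `lip k ≥ 0`, and (iii) the
Kotecký–Preiss clause `Σ_{Z′ ∈ domAt X.1, touchInc Z′ Z} 2·n₅(Z′)·e^{(a₁+d₁)·#Z′} ≤ a₁·#Z` holds for every `Z ∈ domAt X.1`, with
`0 ≤ a₁`, `0 ≤ d₁` — then `TwoPointKP (cubeChart R).geom W act 𝒜 n lip (sizeWeight a₁) (sizeWeight d₁)` (NE9's END-face binder L-A1
in the cube-count currency of `Spine/NE9/CarriersOfRecordFaces`).  A REDUCTION, not a discharge: (i)–(iii) remain hypotheses. -/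
theorem twoPointKP_cubeChart_of_domains {Bg : Type} {Pot : Type*} [NormedAddCommGroup Pot] {W : Set (ℕ → ℝ)}
    {act : ℕ → ℝ → Bg → Pot → Finset (SCube R) → ℂ} {act₅ : ℕ → ℝ → Bg → Pot → R.carriers.Dom → ℂ}
    {n : ℕ → ℝ → Bg → Finset (SCube R) → ℝ} {n₅ : ℕ → ℝ → Bg → R.carriers.Dom → ℝ} {𝒜 : ℕ → Set Pot} {lip : ℕ → ℝ}
    {a₁ d₁ : ℝ} (hact : ∀ k s U Q Z, act k s U Q (footprint Z) = act₅ k s U Q Z)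
    (hn : ∀ k s U Z, n k s U (footprint Z) = n₅ k s U Z) (ha₁ : 0 ≤ a₁) (hd₁ : 0 ≤ d₁) (hlip : ∀ k, 0 ≤ lip k)
    (h₅ : ∀ g ∈ W, ∀ (k : ℕ) (U : Bg) (X : R.carriers.Dom), R.carriers.scale X = k + 1 →
      (∀ Q ∈ 𝒜 k, ∀ Z ∈ R.domAt X.1, ‖act₅ k (g k) U Q Z‖ ≤ n₅ k (g k) U Z) ∧
      (∀ Q ∈ 𝒜 k, ∀ Q' ∈ 𝒜 k, ∀ Z ∈ R.domAt X.1,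
        ‖act₅ k (g k) U Q Z - act₅ k (g k) U Q' Z‖ ≤ lip k * ‖Q - Q'‖ * n₅ k (g k) U Z) ∧
      (∀ Z ∈ R.domAt X.1, ∑ Z' ∈ R.domAt X.1 with touchInc (domainGeometry R) Z' Z,
        2 * n₅ k (g k) U Z' * Real.exp (a₁ * (Z'.2.1.card : ℝ) + d₁ * (Z'.2.1.card : ℝ)) ≤ a₁ * (Z.2.1.card : ℝ))) :
    TwoPointKP (cubeChart R).geom W act 𝒜 n lip ((cubeChart R).supported.sizeWeight a₁)
      ((cubeChart R).supported.sizeWeight d₁) := by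
  refine ⟨fun γ => Supported.sizeWeight_nonneg _ ha₁ γ, fun γ => Supported.sizeWeight_nonneg _ hd₁ γ, hlip, ?_⟩
  intro g hg k U X hX
  obtain ⟨h1, h2, h3⟩ := h₅ g hg k U X hX
  refine ⟨fun Q hQ => ?_, fun Q hQ Q' hQ' => ?_, ?_⟩
  · rw [forall_vol_cubeChart_iff]
    intro Z hZ
    rw [hact, hn]
    exact h1 Q hQ Z hZ
  · rw [forall_vol_cubeChart_iff]
    intro Z hZ
    rw [hact, hact, hn]
    exact h2 Q hQ Q' hQ' Z hZ
  · rw [forall_vol_cubeChart_iff]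
    intro Z hZ
    rw [sum_vol_filter_inc_eq, sizeWeight_footprint]
    refine le_trans (le_of_eq (Finset.sum_congr rfl fun Z' _ => ?_)) (h3 Z hZ)
    rw [hn, sizeWeight_footprint, sizeWeight_footprint]

/-! ## §3 L-A2 `hCup` on the geometry of record from the clause on NE5's domains -/

/-- [folklore] **L-A2 FROM THE DOMAIN SIDE**: the coupling two-point clause at the activity level over NE9's step volume follows
from the same clause over `R.domAt X.1` for the read domain families.  A REDUCTION, not a discharge. -/
theorem cup_cubeChart_of_domains {Bg : Type} {Pot : Type*} [NormedAddCommGroup Pot] {W : Set (ℕ → ℝ)}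
    {act : ℕ → ℝ → Bg → Pot → Finset (SCube R) → ℂ} {act₅ : ℕ → ℝ → Bg → Pot → R.carriers.Dom → ℂ}
    {n : ℕ → ℝ → Bg → Finset (SCube R) → ℝ} {n₅ : ℕ → ℝ → Bg → R.carriers.Dom → ℝ} {𝒜 : ℕ → Set Pot} {clip : ℕ → ℝ}
    (hact : ∀ k s U Q Z, act k s U Q (footprint Z) = act₅ k s U Q Z)
    (hn : ∀ k s U Z, n k s U (footprint Z) = n₅ k s U Z)
    (h₅ : ∀ g ∈ W, ∀ g' ∈ W, ∀ (k : ℕ) (U : Bg) (X : R.carriers.Dom), R.carriers.scale X = k + 1 → ∀ Q ∈ 𝒜 k,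
      ∀ Z ∈ R.domAt X.1,
        ‖act₅ k (g k) U Q Z‖ ≤ n₅ k (g' k) U Z ∧
          ‖act₅ k (g k) U Q Z - act₅ k (g' k) U Q Z‖ ≤ clip k * |g k - g' k| * n₅ k (g' k) U Z) :
    ∀ g ∈ W, ∀ g' ∈ W, ∀ (k : ℕ) (U : Bg) (X : R.carriers.Dom), R.carriers.scale X = k + 1 → ∀ Q ∈ 𝒜 k,
      ∀ γ ∈ (cubeChart R).geom.vol X,
        ‖act k (g k) U Q γ‖ ≤ n k (g' k) U γ ∧
          ‖act k (g k) U Q γ - act k (g' k) U Q γ‖ ≤ clip k * |g k - g' k| * n k (g' k) U γ := by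
  intro g hg g' hg' k U X hX Q hQ
  rw [forall_vol_cubeChart_iff]
  intro Z hZ
  rw [hact, hact, hn]
  exact h₅ g hg g' hg' k U X hX Q hQ Z hZ

end Summit.QuantumFields.BalabanUV.T4Continuum.U3PolymerDictionaryKP

end
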